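import Summits.BirchSwinnertonDyer.BirchSwinnertonDyer.Theorems.ManinLocalTwoThreeAbbesUllmoCesnaviciusManinConstant
import Summits.BirchSwinnertonDyer.BirchSwinnertonDyer.Theorems.AlignedTransportAtTwoMainConjectureTransportAlignedAtTwoMinusPeriodUnitAtTwo
import Summits.BirchSwinnertonDyer.BirchSwinnertonDyer.Theses.ThetaPartnerAtTwo
import Literature.NumberTheory.EllipticCurves.SkinnerUrban2014.PAdicUnitPeriodRatioAnyPrimeProofs
import HarnessLib

set_option autoImplicit false
-- the sub-problem namespace `Summit.BirchSwinnertonDyer.BirchSwinnertonDyer` duplicates a component by design (D-0017)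
set_option linter.dupNamespace false

/-!
# The Greenberg–Vatsal period comparisons at `p = 2` (`Ω(W) = u · Ω⁺_f`, `c_∞ · Ω⁻(W) = u′ · Ω⁻_f`, `|u|₂ = |u′|₂ = 1`) as tree theorems;
# support item `RealPeriodPlusPeriodUnitAtTwoSupply` (stmt-BirchSwinnertonDyer-24944) closed by name

Two statement-only (cite-only) Literature facts at the prime `2` for a globally minimal `W/ℚ` with good reduction at `2`, `E[2]` irreducible,
and newform `f`:

* `realPeriodRat_eq_unit_mul_plusPeriod_two` (`ModularCurvePeriodRatio.lean`): `Ω(W) = u · Ω⁺_f`, `u ∈ ℚ` a `2`-adic unit;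
* `numRealComponents_mul_imaginaryPeriodRat_eq_unit_mul_minusPeriod_two` (`ModularCurveMinusPeriodRatio.lean`): the minus-period twin.

Both were proved in the tree FROM Abbes–Ullmo 1996 Thm. A in lattice form (`SkinnerUrban2014.realPeriodRat_eq_unit_mul_plusPeriod_two_fact_of_abbesUllmo`;
`AlignedTransportAtTwoMinusPeriodUnitAtTwo.numRealComponents_mul_imaginaryPeriodRat_eq_unit_mul_minusPeriod_two_of_abbesUllmo`), and that fact is now
the tree theorem `abbesUllmo_not_dvd_maninConstant_of_not_dvd_level_holds` (p828339: Stevens' inclusion ⟸ the Unbounded Denominators theorem, the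
conjugation obstruction, and the half-index / Kummer-value road with Stevens 1982 Thm. 1.3.1 (b)).  This file discharges both facts and closes the
support item 24944 (route ThetaPartnerAtTwo) BY NAME.

DEPENDENCY / WORDING OF RECORD (director-bsd (848)(C), (849)(1)(4)).  Every theorem here rests on the in-tree term
`calegariDimitrovTang2025_unboundedDenominators_holds` — UDC-dependent; audit (P†) pending; «kernel-closed (UDC-dependent, audit pending)», never
«unconditional».  AS-TYPED vs PRINT: «=» print (Greenberg–Vatsal 2000 Remark 3.4 read at `p = 2` with Abbes–Ullmo; each typed statement weaker than
its source).  BSD is not proved by this; nothing here is an announcement.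
[cite: GreenbergVatsal2000, §3, Remark 3.4] [cite: AbbesUllmo1996, Thm. A] [cite: EdixhovenManin1991, Prop. 2] [cite: CalegariDimitrovTang2025, Thm. 1.0.1]
-/

noncomputable section

open Literature.NumberTheory.EllipticCurves Literature.NumberTheory.EllipticCurves.ModularForms
open Literature.NumberTheory.EllipticCurves.SkinnerUrban2014

namespace Summit.BirchSwinnertonDyer.BirchSwinnertonDyer.Theorems

/-- **Greenberg–Vatsal 2000, Remark 3.4 at good `p = 2` holds** (the Literature named fact `realPeriodRat_eq_unit_mul_plusPeriod_two`):
`Ω(W) = u · Ω⁺_f` with `|u|₂ = 1`, from Abbes–Ullmo's Thm. A as a tree theorem.  UDC-dependent; audit (P†) pending.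
[cite: GreenbergVatsal2000, §3, Remark 3.4] [cite: AbbesUllmo1996, Thm. A] -/
theorem realPeriodRat_eq_unit_mul_plusPeriod_two_holds : realPeriodRat_eq_unit_mul_plusPeriod_two :=
  realPeriodRat_eq_unit_mul_plusPeriod_two_fact_of_abbesUllmo abbesUllmo_not_dvd_maninConstant_of_not_dvd_level_holds

/-- **The minus-period comparison at good `p = 2` holds** (the Literature named fact
`numRealComponents_mul_imaginaryPeriodRat_eq_unit_mul_minusPeriod_two`), from Abbes–Ullmo's Thm. A as a tree theorem.  UDC-dependent; audit
(P†) pending. [cite: GreenbergVatsal2000, §3, Remark 3.4] [cite: AbbesUllmo1996, Thm. A] -/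
theorem numRealComponents_mul_imaginaryPeriodRat_eq_unit_mul_minusPeriod_two_holds :
    numRealComponents_mul_imaginaryPeriodRat_eq_unit_mul_minusPeriod_two :=
  AlignedTransportAtTwoMinusPeriodUnitAtTwo.numRealComponents_mul_imaginaryPeriodRat_eq_unit_mul_minusPeriod_two_of_abbesUllmo
    abbesUllmo_not_dvd_maninConstant_of_not_dvd_level_holds

/-- **Support item `RealPeriodPlusPeriodUnitAtTwoSupply` (stmt-BirchSwinnertonDyer-24944), proved by name** through route ThetaPartnerAtTwo's
declaration.  UDC-dependent; audit (P†) pending; BSD is NOT proved by this. [cite: GreenbergVatsal2000, §3, Remark 3.4] [cite: AbbesUllmo1996, Thm. A] -/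
theorem ThetaPartnerAtTwo.RealPeriodPlusPeriodUnitAtTwoSupply_proof :
    Summit.BirchSwinnertonDyer.BirchSwinnertonDyer.Theses.ThetaPartnerAtTwo.RealPeriodPlusPeriodUnitAtTwoSupply :=
  realPeriodRat_eq_unit_mul_plusPeriod_two_holds

end Summit.BirchSwinnertonDyer.BirchSwinnertonDyer.Theorems

end
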